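import Summits.ABC.StewartYu.GenThreeFrameSpecArchW
import Summits.ABC.StewartYu.ArchG3XiOutput
import Summits.ABC.StewartYu.ArchG3FrameGlue
import HarnessLib

/-!
# Cell abc-stewartyu, WP-L.A (crux r2 `ArchCoreRat`, stmt-ABC-20502), line `arch-g3-frame`: the END-level package `EndAt` and the
# content of the stub `stub_endArch` (plan g12 RULINGS R32 (c3), R37 (ii), R38 (2), protocol R39 (a))

`Summits/ABC/StewartYu/ArchG3LineEnd.lean` — cell `abc-stewartyu` (HOME `run/shared/lean/pub/abc-stewartyu/`), route `YuMatveevShapeRat` (rung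
A1.L), seat p4 (g9, registrar of the r2 line and owner of its END stub).  One plain `Prop`-valued definition and one theorem; no named fact.

`ArchG3Line.EndAt c Y n a b A` is what START + LEVELS of the one-stage saturated archimedean frame deliver to the END for ONE reduced datum
(the boundary fixed by R37 (ii)/(bk2): lp-1's `ArchG3ScheduleQ.lastLevelInv_feldR` ∧ the virtual box): saturation data `(θ > 0, b̃, j̃₀, U, N ≥ 1)`
with `θᵢ^N = ∏ aⱼ^{Uᵢⱼ}`, `b̃ ᵥ* U = N·b`, `ν = (· ᵥ* U)` injective; the last-level Δ-invariant `ArchLvInv (feldR ·.1 H) B v pv lo L P w γ c e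
{|x| ≤ N₀} T` of the frame `setupOf n θ _ b̃ j̃₀ _`; degrees `ℓ₀ ≤ D₀` on `B`; exponents injective in `λ`; the VIRTUAL box `|ν(vᵢ)ⱼ| ≤ Bvⱼ`;
the END letters `(n+1)X′ ≤ N₀`, `(n+1)S₀ < T`; and the record obligations `RecordArchW (c^·) Y n A D₀ S₀ X′ Bv`.  The theorem
`ArchG3Line.frameArchW_of_endAt` is the END stub's content VERBATIM (`Sig.stub_endArch` of the registered skeleton is this text with `EndAt`):
`EndAt ⇒ ∃ ξ j₀ D₀ S₀ X D, ξ independent ∧ b j₀ ≠ 0 ∧ FrameOutputReal n ξ b j₀ D₀ S₀ X D ∧ RecordArchW …` — by `ArchG3XiOutput.frameOutputReal_sat`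
at `ξ = rootUnitsN N a`, output pivot `k₀`, and `hind_rootUnitsN`.  The skeleton discharges `stub_endArch` by this name (R39 (b)).

WHAT THIS IS NOT: no START, no packs, no record; no crux moves by itself.

References: Yu. V. Nesterenko, LNM 1819 (2003), §5.1 (5.1)–(5.6) (p. 95–98); K. Yu, Acta Math. 211 (2013), §6.
-/

noncomputable section

open Finset
open scoped Matrix
open Summit.ABC.StewartYu.GenThreeFrameSpecArchW (RecordArchW)
open Summit.ABC.StewartYu.GenThreeFrameSpecTwoRat (FrameOutputReal)
open Summit.ABC.StewartYu.GenThreeFrameSpecOddRat (rootUnitsN hind_rootUnitsN)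
open Summit.ABC.StewartYu.FeldmanBasis (feldR)
open Summit.ABC.StewartYu.ArchG3FrameGlue (setupOf)

namespace Summit.ABC.StewartYu.ArchG3Line

/-- **What START + LEVELS deliver to the END, for one reduced datum** (see the module docstring for the list).
[cite: Nesterenko2003, §5.1 (5.1)–(5.6), §5.2; shape only] -/
def EndAt (c : ℝ) (Y : ℕ → ℝ) (n : ℕ) (a : Fin n → ℚ) (b : Fin n → ℤ) (A : Fin n → ℝ) : Prop :=
  ∃ (θ : Fin n → ℚ) (hθ : ∀ i, 0 < θ i) (bt : Fin n → ℤ) (jt : Fin n) (hjt : bt jt ≠ 0)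
    (U : Matrix (Fin n) (Fin n) ℤ) (Nsat H : ℕ) (B : Finset (ℕ × (Fin n → ℤ))) (v : (ℕ × (Fin n → ℤ)) → Fin n → ℤ)
    (pv : (ℕ × (Fin n → ℤ)) → ℤ) (lo : Fin n → ℤ) (L : Fin n → ℕ) (P : ℤ) (w γ : ℝ) (cc : ℤ) (e : Fin n → ℤ)
    (N₀ T D₀ S₀ X' : ℕ) (Bv : Fin n → ℕ),
    1 ≤ Nsat ∧ (∀ i, θ i ^ Nsat = ∏ j, a j ^ U i j) ∧ bt ᵥ* U = (Nsat : ℤ) • b ∧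
    (∀ w₁ w₂ : Fin n → ℤ, w₁ ᵥ* U = w₂ ᵥ* U → w₁ = w₂) ∧
    (setupOf n θ hθ bt jt hjt).ArchLvInv (fun i => feldR i.1 H) B v pv lo L P w γ cc e {x : ℤ | |x| ≤ (N₀ : ℤ)} T ∧
    (∀ i ∈ B, i.1 ≤ D₀) ∧ (∀ i ∈ B, ∀ i' ∈ B, v i = v i' ↔ i.2 = i'.2) ∧ (∀ i ∈ B, ∀ j, |(v i ᵥ* U) j| ≤ (Bv j : ℤ)) ∧
    (n + 1) * X' ≤ N₀ ∧ (n + 1) * S₀ < T ∧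
    RecordArchW (fun r => c ^ r) Y n A D₀ S₀ X' Bv

/-- **THE END STUB's CONTENT (`stub_endArch` of line `arch-g3-frame`)**: `EndAt ⇒` the conclusion of `FrameArchW` for every positive
independent datum with a pivot `k₀` — real roots `ξ = rootUnitsN N a` (independent by `hind_rootUnitsN`), output pivot `j₀ := k₀`, the ξ-output
`ArchG3XiOutput.frameOutputReal_sat`, and the record clauses carried through. [cite: Nesterenko2003, §5.1 (5.3)–(5.4), p. 96] -/
theorem frameArchW_of_endAt :
    ∀ (c : ℝ) (Y : ℕ → ℝ) (n : ℕ) (a : Fin n → ℚ) (b : Fin n → ℤ) (A : Fin n → ℝ) (k₀ : Fin n),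
      (∀ j, 0 < a j) → (∀ μ : Fin n → ℤ, ∏ j, a j ^ μ j = 1 → μ = 0) → b k₀ ≠ 0 →
      EndAt c Y n a b A →
      ∃ (ξ : Fin n → ℂˣ) (j₀ : Fin n) (D₀ S₀ X : ℕ) (D : Fin n → ℕ),
        (∀ φ : Fin n → ℤ, ∏ j, ξ j ^ φ j = 1 → φ = 0) ∧ b j₀ ≠ 0 ∧
        FrameOutputReal n ξ b j₀ D₀ S₀ X D ∧ RecordArchW (fun r => c ^ r) Y n A D₀ S₀ X D := by
  intro c Y n a b A k₀ ha hind hk₀ hE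
  obtain ⟨θ, hθ, bt, jt, hjt, U, Nsat, H, B, v, pv, lo, L, P, w, γ, cc, e, N₀, T, D₀, S₀, X', Bv, hN, hU, hbU, hνinj, hinv, hdeg,
    hv, hbox, hX, hS, hrec⟩ := hE
  refine ⟨rootUnitsN Nsat a ha, k₀, D₀, S₀, X', Bv, hind_rootUnitsN Nsat (by omega) a ha hind, hk₀, ?_, hrec⟩
  exact ArchG3Setup.ArchLvInv.frameOutputReal_sat (S := setupOf n θ hθ bt jt hjt) hinv a ha U hN hU b hbU hνinj hdeg hv hbox
    hX hS k₀

end Summit.ABC.StewartYu.ArchG3Line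

end
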